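import Summits.BirchSwinnertonDyer.Rank1Residual.Additive.QuadraticBranchEvenLocalControl
import Summits.BirchSwinnertonDyer.Rank1Residual.Additive.LocalPreimageCardSignedTwist
import Summits.BirchSwinnertonDyer.Rank1Residual.Additive.QuadraticBranchTamagawaAtOddPrime
import Literature.NumberTheory.EllipticCurves.LeadingTermPPartProofs
import HarnessLib

/-!
# The LOWER inequality of the even exact control WITHOUT the Kitajima–Otsuki input:
# `v_p(L_p⁺(V, η, 0)) ≤ ord_p #Sel_{p^∞}(W/ℚ) + ord_p(Tam(W)/#W(ℚ)_tors²)` from (R1⁺) + (C1_η) ALONE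
# (cell `bsd-potss`, seat `bsd-potss-ctrl` g2; TARGET.md v2 §1.1 T-e2-r0 — the half that `BSD(W, p)`
# needs in analytic rank `0`, with the no-finite-submodule reading (R2⁺) REMOVED; even twin of x1b's
# `hnf`-free Selmer side, files 120–121 / 126)

HONEST FRAMING (cell `bsd-potss`, run/shared/lean/pub/bsd-potss/; FULL-BSD rank ≤ 1 programme,
tranche 1b): THEOREMS ONLY — no definition, no named Literature fact, no Summits-side fact
`def … : Prop`, no `sorry`, axioms standard. CONDITIONAL on exactly: the typed reading (R1⁺)
`EvenBranchPlusCharIdealOfPlusMCAt` (C1_η read on the `W`-coordinate plus dual data) with (C1_η)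
`QuadraticBranchPlusMainConjectureAt V p` INSIDE it (OPEN for non-CM `V`). NOT used: (R2⁺)
(Kitajima–Otsuki), (L0⁺) (now the theorem `evenBranchPlusLocalControlZeroAt_holds`), any named fact.
Nothing is booked; no label / mark / count moves; Gss2 / O5a stay OPEN; nothing about `BSD(W, p)` of
any pair is claimed here.

## What

* §1 (tree) `IwasawaAlgebra.finite_coinvariants_of_constantCoeff_ne_zero` — for a finitely generated
  torsion `Λ`-module `X` with `f ∈ char(X)` and `f(0) ≠ 0`: `X/TX` is FINITE (no finite-submodule
  hypothesis: `rank_{ℤ_p} X/TX ≤ ord_T f = 0`).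
* §2 `EvenControlZero.finite_localPreimage_of_constantCoeff_ne_zero` — hence, for the `p*`-twist `W`
  of a good `a_p = 0` curve and ANY strict signed dual datum (sign `ε`) with `X` f.g. torsion,
  `char = (f)`, `f(0) ≠ 0`: `A₀ = Sel^{loc,∞}(W/ℚ)` is FINITE (`A₀ ↪ (Sel^{ε,str}_∞)^Γ`, [K] Lemma 9.1,
  and `#(Sel_∞)^Γ = #(X/TX)` by Pontryagin duality) — so x1b's `hnf`-free Lemma 4.2
  (`StrictSignedControlZero.constantCoeff_mul_natCard_invariants_eq_of_quadraticTwist_signedPrime`: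
  `f(0)·#X[T] = u·#A₀`) applies: **`v_p(f(0)) ≤ ord_p #A₀`**.
* §3 **`EvenControlZero.finite_and_valuation_le_padicValNat_card_add_of_reading`** — T-e2-r0, the
  LOWER inequality, modulo (R1⁺) ONLY: for `W` globally minimal, `p` ODD (so the `a₃ = 0` share of
  `p = 3` is included: `ord_p c_p(W) = 0` by cc-typer-5's `…_signedPrime_of_odd`), the good `a_p = 0` twin `V`
  with (C1_η), newform `f`, period ratio `ϖ`, ANY `L` with `IsQuadraticBranchPlusLFunction f p ϖ L` and
  `L(0) ≠ 0`: `Sel_{p^∞}(W/ℚ)` is finite and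
  **`v_p(L(0)) ≤ ord_p #Sel_{p^∞}(W/ℚ) + ord_p(Tam(W)/#W(ℚ)_tors²)`** — `v_p(L(0)) ≤ ord_p #A₀⁺ =
  ord_p #Sel + ord_p #(A₀⁺⧸Sel⁺_0)` (Lagrange, `#Sel⁺(W/ℚ_0) = #Sel_{p^∞}(W/ℚ)`, file 1), the defect
  bound of file 4 under (L0⁺) (a theorem) and x1b's bookkeeping. The defect of the EQUALITY is exactly
  `#X⁺[T] = #H¹(Γ, Sel⁺_∞)` (what (R2⁺) kills) plus the Cassels–Poitou–Tate term (sequel).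

References: [GreenbergLNM1716] §3 Lemma 3.1–3.3 (pp. 85–90), §4 Lemma 4.2 (p. 102); [Kobayashi2003]
§4 (p. 8), Lemma 9.1 (p. 25), Thm. 9.3 with (9.33) (pp. 26–27); [Washington1997] §13.2;
[CoatesSchneiderSujatha2003] §3 (30)–(31).
-/

noncomputable section

open scoped Classical MatrixGroups ModularForm

open CongruenceSubgroup Field Function NumberField IsDedekindDomain WeierstrassCurve
open Literature.NumberTheory.EllipticCurves
open Literature.NumberTheory.EllipticCurves.ModularForms
open Literature.NumberTheory.EllipticCurves.Kobayashi2003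
open Literature.NumberTheory.EllipticCurves.Rank1Residual
open Literature.NumberTheory.GaloisRepresentations
open Literature.NumberTheory.EllipticCurves.IwasawaAlgebra
open Literature.NumberTheory.EllipticCurves.IwasawaDual ZpExtension

universe u

namespace Summit.BirchSwinnertonDyer.Rank1Residual.Additive

/-! ## §2 `A₀` is finite and `v_p(f(0)) ≤ ord_p #A₀`, `hnf`-free -/

namespace EvenControlZero

section Finite

variable {p : ℕ} [hp : Fact p.Prime] (κ : ZpExtension ℚ p) (W : WeierstrassCurve ℚ) [W.IsElliptic]
  (ε : ℤˣ)

/-- **`A₀ = Sel^{loc,∞}(W/ℚ)` is finite from `X` torsion, `char = (f)`, `f(0) ≠ 0` ALONE** (any sign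
`ε`; the `p*`-twist `W` of a globally minimal good `a_p = 0` curve, `p` odd): `A₀ = h₀⁻¹(Sel^{ε,str}_∞)`
embeds in `(Sel^{ε,str}_∞)^Γ` ([K] Lemma 9.1, `exists_injective_toEndInvariants`, `W(ℚ_∞)[p^∞] = 0`
for the twist), whose order is `#(X/TX)` (Pontryagin), finite by §1.
[cite: Kobayashi2003, Lemma 9.1 (p. 25), Prop. 8.7 (p. 16)] [cite: GreenbergLNM1716, §3 Lemma 3.1, §4 Lemma 4.2] -/
theorem finite_localPreimage_of_constantCoeff_ne_zero (hp2 : p ≠ 2)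
    (C : VariableChange ℚ) (V : WeierstrassCurve ℚ) [V.IsElliptic] [V.IsGloballyMinimal]
    (hCV : C • W.quadraticTwist ((-1) ^ (p / 2) * p) = V)
    (hgood : V.HasGoodReductionAtPrime p) (hap : V.frobeniusTrace p = 0)
    {γ : Field.absoluteGaloisGroup ℚ} (hγ : κ.IsTopGenerator γ)
    (D : StrictSignedSelmerDualData W κ ℚ_[p] γ ε)
    [Module.Finite (IwasawaAlgebra p) D.X] (hX : Module.IsTorsion (IwasawaAlgebra p) D.X)
    {f : IwasawaAlgebra p} (hf : D.charIdeal = Ideal.span {f}) (h0 : PowerSeries.constantCoeff f ≠ 0) :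
    Finite (↥((W.selmerInfty κ ⊓
        ⨅ σ : Field.absoluteGaloisGroup ℚ,
          (localKummerOverOfEmb W p κ.kerSubgroup (closureEmb (K := ℚ) ℚ_[p])
              (⨆ m, strictSignedLocalPoints κ ℚ_[p] W ε m)).comap (W.conjH1 p κ.kerSubgroup σ)).comap
        (W.layerToInfty κ 0))) := by
  obtain ⟨M, hΔ, hA, hVM⟩ := exists_goodSupersingularPadicModel hp2 V hgood hap
  obtain ⟨S, hS⟩ := exists_finset_forall_not_mem_good W p
  have hc := sq_ne_neg_one_pow_mul_prime hp.out (p / 2)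
  have hB := fixedPoints_kerSubgroup_geomPrimaryTorsion_eq_bot_of_quadraticTwist κ hp2 W hc C hCV M hΔ hA hVM
  have htors := eq_zero_of_prime_pow_smul_eq_zero_localFixedPointsOfEmb_kerSubgroup_of_quadraticTwist κ
    (closureEmb (K := ℚ) ℚ_[p]) hp2 W hc C hCV M hΔ hA hVM
  rw [← comap_layerToInfty_zero_strictSignedSelmerInfty_eq W κ ℚ_[p] ε S hS htors]
  -- `X/TX` finite ⟹ `(Sel_∞)^Γ` finite ⟹ `A₀` finite
  have hpair := StrictSignedControlZero.isDualPair (W := W) (κ := κ) (E := ℚ_[p]) (ε := ε) D hγ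
  haveI hfinco : Finite (coinvariants p D.X) :=
    IwasawaAlgebra.finite_coinvariants_of_constantCoeff_ne_zero p D.X hX f
      (by rw [← D.charIdeal_def, hf]; exact Ideal.mem_span_singleton_self f) h0
  haveI hfinInv := hpair.finite_coinvariants_iff.mp hfinco
  obtain ⟨φ, hφ, -⟩ := SubSelmerControlZero.exists_injective_toEndInvariants W hγ hB
    (coe_conjStrictSignedSelmerInfty_sub_one_apply W κ ℚ_[p] ε γ)
    ((strictSignedSelmerInfty W κ ℚ_[p] ε).comap (W.layerToInfty κ 0)) (AddSubgroup.map_comap_le _ _)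
  exact Finite.of_injective φ hφ

/-- **`v_p(f(0)) ≤ ord_p #A₀`, `hnf`-free**: with `A₀` finite (previous theorem), x1b's `f(0)·#X[T] =
u·#A₀` (`#X[T] = p^b`, `u ∈ ℤ_p^×`) gives `v_p(f(0)) + b = ord_p #A₀`.
[cite: GreenbergLNM1716, §4 Lemma 4.2 (p. 102)] [cite: CoatesSchneiderSujatha2003, §3 (30)–(31)] -/
theorem valuation_constantCoeff_le_padicValNat_card_localPreimage (hp2 : p ≠ 2)
    (C : VariableChange ℚ) (V : WeierstrassCurve ℚ) [V.IsElliptic] [V.IsGloballyMinimal]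
    (hCV : C • W.quadraticTwist ((-1) ^ (p / 2) * p) = V)
    (hgood : V.HasGoodReductionAtPrime p) (hap : V.frobeniusTrace p = 0)
    {γ : Field.absoluteGaloisGroup ℚ} (hγ : κ.IsTopGenerator γ)
    (D : StrictSignedSelmerDualData W κ ℚ_[p] γ ε)
    [Module.Finite (IwasawaAlgebra p) D.X] (hX : Module.IsTorsion (IwasawaAlgebra p) D.X)
    {f : IwasawaAlgebra p} (hf : D.charIdeal = Ideal.span {f}) (h0 : PowerSeries.constantCoeff f ≠ 0) :
    ((PowerSeries.constantCoeff f : ℤ_[p]) : ℚ_[p]).valuation ≤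
      padicValNat p (Nat.card (↥((W.selmerInfty κ ⊓
        ⨅ σ : Field.absoluteGaloisGroup ℚ,
          (localKummerOverOfEmb W p κ.kerSubgroup (closureEmb (K := ℚ) ℚ_[p])
              (⨆ m, strictSignedLocalPoints κ ℚ_[p] W ε m)).comap (W.conjH1 p κ.kerSubgroup σ)).comap
        (W.layerToInfty κ 0)))) := by
  haveI := finite_localPreimage_of_constantCoeff_ne_zero κ W ε hp2 C V hCV hgood hap hγ D hX hf h0
  obtain ⟨-, ⟨b, hb⟩, u, hu⟩ :=
    StrictSignedControlZero.constantCoeff_mul_natCard_invariants_eq_of_quadraticTwist_signedPrime κ W ε hp2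
      C V hCV hgood hap hγ D hX hf
  set A := Nat.card (↥((W.selmerInfty κ ⊓
        ⨅ σ : Field.absoluteGaloisGroup ℚ,
          (localKummerOverOfEmb W p κ.kerSubgroup (closureEmb (K := ℚ) ℚ_[p])
              (⨆ m, strictSignedLocalPoints κ ℚ_[p] W ε m)).comap (W.conjH1 p κ.kerSubgroup σ)).comap
        (W.layerToInfty κ 0))) with hAdef
  have hApos : A ≠ 0 := by rw [hAdef]; exact Nat.card_pos.ne'
  -- valuations in `ℚ_p`: `v(f(0)) + b = v(u) + v(#A₀) = ord_p #A₀`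
  have h1 : ((PowerSeries.constantCoeff f : ℤ_[p]) : ℚ_[p]) * ((p : ℚ_[p]) ^ b) =
      ((u : ℤ_[p]) : ℚ_[p]) * (A : ℚ_[p]) := by
    have h := congrArg (fun z : ℤ_[p] ↦ (z : ℚ_[p])) hu
    simp only [PadicInt.coe_mul, PadicInt.coe_natCast] at h
    rw [hb] at h
    push_cast at h
    exact h
  have hf0 : ((PowerSeries.constantCoeff f : ℤ_[p]) : ℚ_[p]) ≠ 0 := by
    rw [Ne, PadicInt.coe_eq_zero]; exact h0
  have hpb : ((p : ℚ_[p]) ^ b) ≠ 0 := pow_ne_zero _ (Nat.cast_ne_zero.mpr hp.out.ne_zero)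
  have hu0 : ((u : ℤ_[p]) : ℚ_[p]) ≠ 0 := PadicInt.coe_ne_zero.mpr (Units.ne_zero u)
  have hA0 : (A : ℚ_[p]) ≠ 0 := Nat.cast_ne_zero.mpr hApos
  have hval := congrArg Padic.valuation h1
  rw [Padic.valuation_mul hf0 hpb, Padic.valuation_mul hu0 hA0, Padic.valuation_pow, Padic.valuation_p,
    Padic.valuation_natCast] at hval
  have huv : (((u : ℤ_[p]) : ℚ_[p])).valuation = 0 := by
    have h2 : ((u : ℤ_[p]) * ((u⁻¹ : ℤ_[p]ˣ) : ℤ_[p])).valuation = 0 := by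
      rw [Units.mul_inv, PadicInt.valuation_one]
    rw [PadicInt.valuation_mul (Units.ne_zero u) (Units.ne_zero u⁻¹)] at h2
    rw [PadicInt.valuation_coe]
    exact_mod_cast Nat.eq_zero_of_add_eq_zero_right h2
  rw [huv, zero_add, mul_one] at hval
  have hbnn : (0 : ℤ) ≤ (b : ℤ) := Int.natCast_nonneg b
  linarith

end Finite

/-! ## §3 The LOWER inequality of T-e2-r0 modulo (R1⁺) only -/

section Lower

variable (W : WeierstrassCurve ℚ) [W.IsElliptic] [W.IsGloballyMinimal] (p : ℕ) [hp : Fact p.Prime]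

/-- **T-e2-r0, the LOWER inequality, modulo (R1⁺) ONLY** (no (R2⁺) / Kitajima–Otsuki; (L0⁺) is the
theorem `evenBranchPlusLocalControlZeroAt_holds`). For `W` globally minimal, `p` ODD (`p = 3` with
`a₃(V) = 0` included), the good `a_p = 0` twin `V` (`C • W.quadraticTwist ((−1)^{p/2} p) = V`) with (C1_η), its newform `f`, the
period ratio `ϖ` and ANY `L` with `IsQuadraticBranchPlusLFunction f p ϖ L`, `L(0) ≠ 0`:
**`Sel_{p^∞}(W/ℚ)` is finite and `v_p(L(0)) ≤ ord_p #Sel_{p^∞}(W/ℚ) + ord_p(Tam(W)/#W(ℚ)_tors²)`.**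
Proof: (R1⁺) ⟹ `X⁺` torsion, `char = (L)`; §2 ⟹ `A₀⁺` finite and `v_p(L(0)) ≤ ord_p #A₀⁺`; Lagrange
and file 1 ⟹ `ord_p #A₀⁺ = ord_p #Sel_{p^∞}(W/ℚ) + ord_p #(A₀⁺⧸Sel⁺_0)`; file 4 under (L0⁺) ⟹
`ord_p #(A₀⁺⧸Sel⁺_0) ≤ ∑_{v∈S, v∤p} ord_p c_v(W) = ord_p Tam(W)` (`p ∤ c_p(W)` at every odd `p`:
cc-typer-5's `padicValNat_localTamagawaNumber_eq_zero_of_quadraticTwist_signedPrime_of_odd`; `p ∤ #W(ℚ)_tors`).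
CONDITIONAL on (R1⁺) and (C1_η); nothing booked. [cite: Kobayashi2003, §4 (p. 8), Lemma 9.1 (p. 25), Thm. 9.3 with (9.33) (pp. 26–27)]
[cite: GreenbergLNM1716, §3 Lemma 3.3, §4 Thm. 4.1 and Lemma 4.2 (p. 102)]
[cite: SilvermanAEC2009, Thm. VII.6.1 (Kodaira–Néron) and Prop. VII.3.1] -/
theorem finite_and_valuation_le_padicValNat_card_add_of_reading
    (hR1 : EvenBranchPlusCharIdealOfPlusMCAt W p)
    (V : WeierstrassCurve ℚ) [V.IsElliptic] [V.IsGloballyMinimal] (C : VariableChange ℚ)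
    {N : ℕ} [NeZero N] {f : CuspForm (Gamma0 N) 2}
    (hp2 : p ≠ 2) (hCV : C • W.quadraticTwist ((-1) ^ (p / 2) * p) = V)
    (hgood : V.HasGoodReductionAtPrime p) (hap : V.frobeniusTrace p = 0)
    (h1 : QuadraticBranchPlusMainConjectureAt V p) (hf : IsNewformOf V f) {ϖ : ℚ}
    (hϖ : if Even (p / 2) then (ϖ : ℝ) * V.realPeriodRat = plusPeriod f
      else (ϖ : ℝ) * V.imaginaryPeriodRat = minusPeriod f)
    {L : IwasawaAlgebra p} (hL : IsQuadraticBranchPlusLFunction f p ϖ L)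
    (h0 : PowerSeries.constantCoeff L ≠ 0) :
    Finite ↥(W.selmerGroupPInfty p) ∧
      ((PowerSeries.constantCoeff L : ℤ_[p]) : ℚ_[p]).valuation ≤
        (padicValNat p (Nat.card ↥(W.selmerGroupPInfty p)) : ℤ) +
          padicValRat p ((W.tamagawaProduct : ℚ) / (W.torsionOrder : ℚ) ^ 2) := by
  set v₀ := (Rat.HeightOneSpectrum.primesEquiv (R := 𝓞 ℚ)).symm ⟨p, hp.out⟩ with hv₀
  set κ := CyclotomicZp.zpExtension p with hκdef
  -- the cyclotomic `ℤ_p`-extension of `ℚ`, a normalised topological generator, a plus dual datum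
  obtain ⟨γ, hγ, hχ⟩ := CyclotomicZp.exists_isTopGenerator_zpExtension p
  have hκ := CyclotomicZp.isCyclotomic_zpExtension p
  have hγc : IsCyclotomicVariable p γ := ⟨1, IsOfFinOrder.one, by rw [mul_one]; exact hχ⟩
  obtain ⟨D⟩ := nonempty_strictSignedSelmerDualData W κ ℚ_[p] 1 hγ
  -- (R1⁺)
  obtain ⟨hfg, htor, hchar⟩ := hR1 V C hp2 hCV hgood hap h1 hf ϖ hϖ L hL _ γ hκ hγ hγc D
  haveI := hfg
  -- §2: `A₀⁺` finite and `v_p(L(0)) ≤ ord_p #A₀⁺`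
  set A₀ := (W.selmerInfty κ ⊓
      ⨅ σ : Field.absoluteGaloisGroup ℚ,
        (localKummerOverOfEmb W p κ.kerSubgroup (closureEmb (K := ℚ) ℚ_[p])
            (⨆ m, strictSignedLocalPoints κ ℚ_[p] W 1 m)).comap (W.conjH1 p κ.kerSubgroup σ)).comap
      (W.layerToInfty κ 0) with hA₀def
  haveI hfinA : Finite A₀ :=
    finite_localPreimage_of_constantCoeff_ne_zero κ W 1 hp2 C V hCV hgood hap hγ D htor hchar h0
  have hvA := valuation_constantCoeff_le_padicValNat_card_localPreimage κ W 1 hp2 C V hCV hgood hap hγ D htor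
    hchar h0
  -- `Sel⁺(W/ℚ_0) ≤ A₀⁺`, `#Sel⁺(W/ℚ_0) = #Sel_{p^∞}(W/ℚ)`, Lagrange
  obtain ⟨M, hΔ, hA, hVM⟩ := exists_goodSupersingularPadicModel hp2 V hgood hap
  obtain ⟨S, hS⟩ := exists_finset_forall_not_mem_good W p
  have hc := sq_ne_neg_one_pow_mul_prime hp.out (p / 2)
  have htorsInf := eq_zero_of_prime_pow_smul_eq_zero_localFixedPointsOfEmb_kerSubgroup_of_quadraticTwist κ
    (closureEmb (K := ℚ) ℚ_[p]) hp2 W hc C hCV M hΔ hA hVM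
  have hle : strictSignedSelmerLayer W κ ℚ_[p] 1 0 ≤ A₀ := by
    rw [hA₀def, ← comap_layerToInfty_zero_strictSignedSelmerInfty_eq W κ ℚ_[p] 1 S hS htorsInf,
      ← AddSubgroup.map_le_iff_le_comap]
    exact map_layerToInfty_strictSignedSelmerLayer_le W κ ℚ_[p] 1 0
  have hcardS := StrictSignedLayerZero.natCard_strictSignedSelmerLayer_one_zero_eq_selmerGroupPInfty W κ
  haveI hfinS : Finite (strictSignedSelmerLayer W κ ℚ_[p] 1 0) := Finite.of_injective _
    (AddSubgroup.inclusion_injective hle)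
  have hfinSel : Finite ↥(W.selmerGroupPInfty p) :=
    Nat.finite_of_card_ne_zero (by rw [← hcardS]; exact Nat.card_pos.ne')
  have hLag : Nat.card A₀ =
      Nat.card (A₀ ⧸ (strictSignedSelmerLayer W κ ℚ_[p] 1 0).addSubgroupOf A₀) *
        Nat.card ↥(W.selmerGroupPInfty p) := by
    rw [← hcardS, ← Nat.card_congr (AddSubgroup.addSubgroupOfEquivOfLe hle).toEquiv]
    exact AddSubgroup.card_eq_card_quotient_mul_card_addSubgroup _
  have hqpos : Nat.card (A₀ ⧸ (strictSignedSelmerLayer W κ ℚ_[p] 1 0).addSubgroupOf A₀) ≠ 0 :=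
    Nat.card_pos.ne'
  have hSelpos : Nat.card ↥(W.selmerGroupPInfty p) ≠ 0 := by
    haveI := hfinSel; exact Nat.card_pos.ne'
  have hordA : padicValNat p (Nat.card A₀) =
      padicValNat p (Nat.card (A₀ ⧸ (strictSignedSelmerLayer W κ ℚ_[p] 1 0).addSubgroupOf A₀)) +
        padicValNat p (Nat.card ↥(W.selmerGroupPInfty p)) := by
    rw [hLag, padicValNat.mul hqpos hSelpos]
  refine ⟨hfinSel, ?_⟩
  -- file 4 under (L0⁺): the defect is bounded by the Tamagawa exponents away from `p`
  have hloc := evenBranchPlusLocalControlZeroAt_holds W p V C hp2 hCV hgood hap κ hκ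
  have hdef := StrictSignedControlZero.padicValNat_card_quotient_le_sum_of_loc W κ 1 hκ S hS hloc
  -- bookkeeping: `∑_{v ∈ S, v ∤ p} ord_p c_v = ord_p Tam(W)`, `ord_p #W(ℚ)_tors = 0`
  set T := S.filter (fun v ↦ (p : 𝓞 ℚ) ∉ v.asIdeal) with hT
  have hv₀p : (p : 𝓞 ℚ) ∈ v₀.asIdeal := (natCast_mem_asIdeal_iff_eq_primesEquiv_symm v₀ hp.out).mpr rfl
  have hpT : v₀ ∉ T := fun h ↦ (Finset.mem_filter.mp h).2 hv₀p
  have hTmem : ∀ v : HeightOneSpectrum (𝓞 ℚ), v ≠ v₀ →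
      p ∣ (W.baseChange (v.adicCompletion ℚ)).localTamagawaNumber (v.adicCompletionIntegers ℚ) → v ∈ T := by
    intro v hv hdvd
    refine Finset.mem_filter.mpr ⟨?_, fun hpv ↦ hv ((natCast_mem_asIdeal_iff_eq_primesEquiv_symm v hp.out).mp hpv)⟩
    by_contra hvS
    rw [W.localTamagawaNumber_eq_one_of_hasGoodReductionAt_holds v (hS v hvS).2] at hdvd
    exact hp.out.one_lt.ne' (Nat.dvd_one.mp hdvd)
  have hc0 := padicValNat_localTamagawaNumber_eq_zero_of_quadraticTwist_signedPrime_of_odd W p hp2 C V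
    hCV hgood
  have hTamSum := LevelBridge.sum_padicValNat_localTamagawaNumber_eq_padicValNat_tamagawaProduct W p T hpT
    hTmem hc0
  have htors := eq_zero_of_prime_smul_eq_zero_padic_of_quadraticTwist_goodSupersingular hp2 W C V hCV hgood hap
  have htors0 := LevelBridge.padicValNat_torsionOrder_eq_zero_of_noPTorsion W p htors
  have hTamQ : (W.tamagawaProduct : ℚ) ≠ 0 := by exact_mod_cast W.tamagawaProduct_pos_holds.ne'
  have htQ : (W.torsionOrder : ℚ) ≠ 0 := by exact_mod_cast W.torsionOrder_pos_holds.ne'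
  have hrat : padicValRat p ((W.tamagawaProduct : ℚ) / (W.torsionOrder : ℚ) ^ 2) =
      (padicValNat p W.tamagawaProduct : ℤ) := by
    rw [padicValRat.div hTamQ (pow_ne_zero 2 htQ), padicValRat.pow, padicValRat.of_nat, padicValRat.of_nat,
      htors0]
    simp
  rw [hrat, ← hTamSum]
  have hdef' : (padicValNat p (Nat.card (A₀ ⧸ (strictSignedSelmerLayer W κ ℚ_[p] 1 0).addSubgroupOf A₀)) : ℤ) ≤
      ((∑ v ∈ T, padicValNat p ((W.baseChange (v.adicCompletion ℚ)).localTamagawaNumber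
        (v.adicCompletionIntegers ℚ)) : ℕ) : ℤ) := by exact_mod_cast hdef
  have hordA' : (padicValNat p (Nat.card A₀) : ℤ) =
      (padicValNat p (Nat.card (A₀ ⧸ (strictSignedSelmerLayer W κ ℚ_[p] 1 0).addSubgroupOf A₀)) : ℤ) +
        (padicValNat p (Nat.card ↥(W.selmerGroupPInfty p)) : ℤ) := by exact_mod_cast hordA
  push_cast
  push_cast at hvA
  linarith

end Lower

end EvenControlZero

end Summit.BirchSwinnertonDyer.Rank1Residual.Additive

end
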